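import Mathlib
import Summits.ValiantsHypothesis.ValiantsHypothesis.Theorems.ProofCarryingSymmetryStabilityIff
import Summits.ValiantsHypothesis.ValiantsHypothesis.Theorems.ProofCarryingSymmetryAssembly
import Summits.ValiantsHypothesis.ValiantsHypothesis.Theorems.RestorationQP.Negative.RestorationQPFalseOfArithmeticCFI

/-!
# Route ProofCarryingSymmetry, crux `RestorationQP`, line `registered` — what kills the BET

Lead c3, negative side of the stability bet.  The registered bet S2⁗ (`stub_proofsToDistEquiv`) and the
route's stability statement L (item stmt-ValiantsHypothesis-10358; L ⟺ S2⁗,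
`stabilityOfProvableSymmetry_iff_proofsToDistEquiv`) are refuted by a SUB-EXPONENTIAL PROOF-CARRYING
SEPARATING FAMILY: straight-line circuits `C_n` over `ℂ` on the `n × n` variable matrix with
`P_c(ℂ)`-proofs of all their invariance identities `C_n ∘ σ = C_n` of size `t_n`, where
`|C_n| + t_n + n + 2 = 2^{o(n)}`, whose polynomials separate, for some `ε > 0` and infinitely many `n`,
two `≡^{C^k}`-equivalent `n`-vertex graphs with `k ≥ εn` (values at adjacency matrices).  For then L
would give `S_n`-symmetric circuits of size `(2^{o(n)})^c = 2^{o(n)}` computing the same polynomials,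
which the PROVED Dawar–Wilsenach pipeline forbids (Thm. 5.1 `DawarWilsenach2025_thm51_family`, Thm. 6.4
`DawarWilsenach2025_orbitSize_countingWidth_holds`; the deduction of Thm. 7.1, p. 19, with the permanent
replaced by `Ĉ_n` — the engine `eval_adj_eq_eventually_of_isSymmetric_subexp` of
`Theorems/RestorationQP/Negative/RestorationQPFalseOfArithmeticCFI.lean`).  This is the precise target for the crux's disprover on the bet; no such family is
known (it would in particular be an invariant family with a super-polynomial gap between symmetric and
plain circuit complexity).  Everything here is proved; the hypothesis is written inline.
-/

-- single-problem summit: `Summit.ValiantsHypothesis.ValiantsHypothesis.…` is the namespace by design (D-0017)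
set_option linter.dupNamespace false

noncomputable section

open scoped Classical

namespace Summit.ValiantsHypothesis.ValiantsHypothesis.Theorems

open Filter
open Literature.Computability.AlgebraicComplexity
open Literature.ModelTheory.FiniteModelTheory
open Literature.Computability.Complexity (Circuit tcBasis)

/-- **A sub-exponential proof-carrying separating family refutes L** (the route's stability statement,
item stmt-10358, in the all-`σ` form of line `registered`).  Hypothesis (inline): circuits `C_n` with
size-`t_n` `P_c(ℂ)`-proofs of all `C_n ∘ σ = C_n`, `|C_n| + t_n + n + 2 ≤ 2^{δn}` eventually for every
`δ > 0`, whose polynomials separate `≡^{C^k}`-equivalent `n`-vertex graphs with `k ≥ εn` for some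
`ε > 0` and infinitely many `n`.  L would turn them into symmetric circuits of size
`(|C_n| + t_n + n + 2)^c ≤ 2^{cδn}`, i.e. `2^{o(n)}`, contradicting the engine
`eval_adj_eq_eventually_of_isSymmetric_subexp` of the crux's negative lemma (Dawar–Wilsenach Thms. 5.1, 6.4). [folklore] -/
theorem stabilityOfProvableSymmetry_false_of_subexpSeparating :
    (∃ (C : ∀ n : ℕ, PICircuit ℂ (Fin n × Fin n)) (t : ℕ → ℕ),
      (∀ (n : ℕ) (σ : Equiv.Perm (Fin n)),
        HasPCProofOfSize ((C n).rename fun x : Fin n × Fin n => σ • x) (C n) (t n)) ∧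
      (∀ δ : ℝ, 0 < δ → ∀ᶠ n : ℕ in atTop,
        (((C n).size + t n + n + 2 : ℕ) : ℝ) ≤ (2 : ℝ) ^ (δ * (n : ℝ))) ∧
      ∃ ε : ℝ, 0 < ε ∧ ∃ᶠ n : ℕ in atTop, ∃ k : ℕ, ε * (n : ℝ) ≤ (k : ℝ) ∧
        ∃ X Y : SimpleGraph (Fin n), CkEquiv k X Y ∧
          MvPolynomial.eval (fun ij : Fin n × Fin n => if X.Adj ij.1 ij.2 then (1 : ℂ) else 0)
              (C n).eval ≠
            MvPolynomial.eval (fun ij : Fin n × Fin n => if Y.Adj ij.1 ij.2 then (1 : ℂ) else 0)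
              (C n).eval) →
    ¬ ∃ c : ℕ, ∀ (n t : ℕ) (C : PICircuit ℂ (Fin n × Fin n)),
      (∀ σ : Equiv.Perm (Fin n),
        HasPCProofOfSize (C.rename fun x : Fin n × Fin n => σ • x) C t) →
      ∃ (G : Type) (_ : Fintype G) (D : LabelledArithCircuit ℂ (Fin n × Fin n) Unit G),
        D.IsSymmetric (Equiv.Perm (Fin n)) ∧ D.eval (D.output ()) = C.eval ∧
        Fintype.card G ≤ (C.size + t + n + 2) ^ c := by
  rintro ⟨C, t, hpf, hsub, ε, hε, hfreq⟩ ⟨c, hc⟩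
  have hL : ∀ n, ∃ (G : Type) (_ : Fintype G) (D : LabelledArithCircuit ℂ (Fin n × Fin n) Unit G),
      D.IsSymmetric (Equiv.Perm (Fin n)) ∧ D.eval (D.output ()) = (C n).eval ∧
      Fintype.card G ≤ ((C n).size + t n + n + 2) ^ c := fun n => hc n (t n) (C n) (hpf n)
  choose G hG D hsym hev hcard using hL
  -- size `2^{o(n)}`: `m_n ^ c ≤ (2^{(δ/(c+1)) n})^c ≤ 2^{δ n}`
  have hsmall : ∀ δ : ℝ, 0 < δ → ∀ᶠ n : ℕ in atTop,
      (Fintype.card (G n) : ℝ) ≤ (2 : ℝ) ^ (δ * (n : ℝ)) := by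
    intro δ hδ
    have hδ' : 0 < δ / (c + 1) := div_pos hδ (by positivity)
    filter_upwards [hsub (δ / (c + 1)) hδ'] with n hn
    have hm0 : (0 : ℝ) ≤ (((C n).size + t n + n + 2 : ℕ) : ℝ) := by positivity
    calc (Fintype.card (G n) : ℝ) ≤ ((((C n).size + t n + n + 2) ^ c : ℕ) : ℝ) := by
          exact_mod_cast hcard n
      _ = ((((C n).size + t n + n + 2 : ℕ) : ℝ)) ^ c := by push_cast; ring
      _ ≤ ((2 : ℝ) ^ (δ / (c + 1) * (n : ℝ))) ^ c := pow_le_pow_left₀ hm0 hn c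
      _ = (2 : ℝ) ^ (δ / (c + 1) * (n : ℝ) * c) := by rw [← Real.rpow_mul_natCast (by norm_num)]
      _ ≤ (2 : ℝ) ^ (δ * (n : ℝ)) := by
          refine Real.rpow_le_rpow_of_exponent_le one_le_two ?_
          have hn0 : (0 : ℝ) ≤ n := Nat.cast_nonneg n
          have hc0 : (0 : ℝ) ≤ c := Nat.cast_nonneg c
          have h1 : δ / (c + 1) * c ≤ δ := by
            rw [div_mul_eq_mul_div, div_le_iff₀ (by positivity)]
            nlinarith
          calc δ / (c + 1) * (n : ℝ) * c = δ / (c + 1) * c * n := by ring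
            _ ≤ δ * n := mul_le_mul_of_nonneg_right h1 hn0
  -- the separating data, chosen where it exists; the reference graphs `X n`
  let val : ∀ n, SimpleGraph (Fin n) → ℂ := fun n Γ =>
    MvPolynomial.eval (fun ij : Fin n × Fin n => if Γ.Adj ij.1 ij.2 then (1 : ℂ) else 0) (C n).eval
  let P : ℕ → Prop := fun n => ∃ k : ℕ, ε * (n : ℝ) ≤ (k : ℝ) ∧
    ∃ X Y : SimpleGraph (Fin n), CkEquiv k X Y ∧ val n X ≠ val n Y
  have hP : ∃ᶠ n : ℕ in atTop, P n := hfreq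
  let X : ∀ n, SimpleGraph (Fin n) := fun n =>
    if h : P n then h.choose_spec.2.choose else ⊥
  have hmain := eval_adj_eq_eventually_of_isSymmetric_subexp (fun n => (C n).eval) G D hsym hev
    hsmall X hε
  obtain ⟨n, hn, hPn⟩ := (hmain.and_frequently hP).exists
  have hXn : X n = hPn.choose_spec.2.choose := dif_pos hPn
  obtain ⟨Y, hXY, hne⟩ := hPn.choose_spec.2.choose_spec
  have heq := hn hPn.choose hPn.choose_spec.1 Y (hXn ▸ hXY)
  rw [hXn] at heq
  exact hne heq.symm

/-- **The same family refutes the registered bet S2⁗** (`stub_proofsToDistEquiv` of line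
`registered`), through S2⁗ ⟺ L (`stabilityOfProvableSymmetry_iff_proofsToDistEquiv`).  So a disprover of
the bet must produce a `2^{o(n)}` proof-carrying family whose polynomials have counting width `Ω(n)` —
none is known. [folklore] -/
theorem proofsToDistEquiv_false_of_subexpSeparating :
    (∃ (C : ∀ n : ℕ, PICircuit ℂ (Fin n × Fin n)) (t : ℕ → ℕ),
      (∀ (n : ℕ) (σ : Equiv.Perm (Fin n)),
        HasPCProofOfSize ((C n).rename fun x : Fin n × Fin n => σ • x) (C n) (t n)) ∧
      (∀ δ : ℝ, 0 < δ → ∀ᶠ n : ℕ in atTop,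
        (((C n).size + t n + n + 2 : ℕ) : ℝ) ≤ (2 : ℝ) ^ (δ * (n : ℝ))) ∧
      ∃ ε : ℝ, 0 < ε ∧ ∃ᶠ n : ℕ in atTop, ∃ k : ℕ, ε * (n : ℝ) ≤ (k : ℝ) ∧
        ∃ X Y : SimpleGraph (Fin n), CkEquiv k X Y ∧
          MvPolynomial.eval (fun ij : Fin n × Fin n => if X.Adj ij.1 ij.2 then (1 : ℂ) else 0)
              (C n).eval ≠
            MvPolynomial.eval (fun ij : Fin n × Fin n => if Y.Adj ij.1 ij.2 then (1 : ℂ) else 0)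
              (C n).eval) →
    ¬ ∃ c : ℕ, ∀ (n t : ℕ) (C : PICircuit ℂ (Fin n × Fin n)),
      (∀ σ : Equiv.Perm (Fin n),
        HasPCProofOfSize (C.rename fun x : Fin n × Fin n => σ • x) C t) →
      ∃ C' : PICircuit ℂ (Fin n × Fin n), C'.eval = C.eval ∧
        C'.size ≤ (C.size + t + n + 2) ^ c ∧
        ∀ σ : Equiv.Perm (Fin n),
          (pfSystem ℂ (Fin n × Fin n)).Provable (C'.rename fun x : Fin n × Fin n => σ • x).unfold
            C'.unfold ⊤ (fun s => if s = PIAxiom.A6 then 0 else ⊤) :=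
  fun h hS => stabilityOfProvableSymmetry_false_of_subexpSeparating h
    (stabilityOfProvableSymmetry_iff_proofsToDistEquiv.mpr hS)

end Summit.ValiantsHypothesis.ValiantsHypothesis.Theorems

end
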